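import Mathlib.NumberTheory.SumPrimeReciprocals
import Mathlib.Analysis.SpecialFunctions.Exp
import Mathlib.Topology.Algebra.InfiniteSum.Real
import Mathlib.Tactic.NormNum
import Mathlib.Tactic.NormNum.Prime
import Mathlib.Tactic.Linarith
import Mathlib.Tactic.Positivity
import Mathlib.Tactic.FieldSimp
import Mathlib.Tactic.Ring
import Mathlib.Tactic.GCongr
import Literature.NumberTheory.EllipticCurves.BhargavaSkinnerZhang2014.SupersingularClassesSmallPrimes
import HarnessLib

/-!
# Supersingular classes at every prime `p ≥ 5` via Deuring's mass formula, and the vanishing of the 'closed by class theorem' mass in the limit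

Sources: D. A. Cox, *Primes of the form x² + ny²*, 2nd ed. (Wiley, 2013) [Cox2013], §14.C: the Hurwitz
class number `H(𝒪) = Σ_{𝒪 ⊂ 𝒪' ⊂ 𝒪_K} (2/|𝒪'ˣ|)·h(𝒪')` and Thm. 14.18 (Deuring): for a prime `p > 3` and
`|a| ≤ 2√p` the number of the `p(p - 1)` Weierstrass equations over `𝔽_p` with `p + 1 - a` points is
`((p - 1)/2)·H(a² - 4p)`; the case `a = 0` ("SS = ((p-1)/2)H(-4p)", proof of Thm. 14.18 via (14.20)–(14.21))
counts the supersingular equations, i.e. our trace-zero pairs `(A, B) mod p`;  S. D. Galbraith, *Mathematics of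
Public Key Cryptography* (CUP, 2012) [Galbraith2012], Thm. 9.11.11: the number `S_p` of supersingular
`j ∈ 𝔽_p` is `h(-4p)/2`, `h(-p)`, `2h(-p)` for `p ≡ 1 (4)`, `7 (8)`, `3 (8)` (= B. H. Gross, *Heights and the
special values of L-series* (1987) [Gross1987], (1.11)), and is at most the number `⌊p/12⌋ + ε_p` of
supersingular `j ∈ 𝔽_{p²}`;  N. D. Elkies, Invent. Math. 89 (1987) [Elkies1987] (every `E/ℚ` has infinitely many
supersingular primes — quoted in a docstring only);  É. Fouvry, M. R. Murty, Canad. J. Math. 48 (1996)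
[FouvryMurty1996] (the average number of supersingular primes `≤ x` over the box family is `~ (π/3)√x/log x` —
quoted as context only); M. Bhargava, C. Skinner, W. Zhang, arXiv:1407.1826v2 [BhargavaSkinnerZhang2014] §3.1
(in-family densities of residue classes, normalisation `1 - p⁻¹⁰`, as in the imported files); and Mathlib's
`not_summable_one_div_on_primes` (Euler: `Σ 1/p = ∞`).  Locators read on the held texts by the `pub-bsdpct`
engine seat, 2026-08-18 (`book:cox2013-primes-form-…` pp. 324/327, `book:galbraithnd-mathematics-public-key-
cryptography` p. 212).

What is proved here (kernel-checked; no statement about elliptic curves over `ℚ` is asserted — the link to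
supersingular reduction is the CITED mass formula, entering only through the hypothesis `p - 1 ≤ N p` of §3):
* (§1) Deuring's formula as ARITHMETIC: `deuringNss p h₄ h₁ = ((p - 1)/2)·(h₄ + [p ≡ 3 (4)]·h₁)` with the class
  numbers `h₄ = h(-4p)`, `h₁ = h(-p)` supplied as literals (a 65-row table for `5 ≤ p ≤ 331`, computed by
  reduced-form enumeration in the bundle's `numerics/open_primes.py`, three implementations agreeing); on the table,
  `deuringNss = (p - 1)·S_p` with Gross's `S_p`, `1 ≤ S_p ≤ p/12 + 2`, and at `p = 5, 7, 11, 13` the formula returns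
  EXACTLY the trace-zero class counts `4, 6, 20, 12` decided in `SupersingularClassesSmallPrimes` §2 (`decide`).
* (§2) the elementary inequalities behind the limit: `μ_mult p > 1/(2p)`; `μ_ssN p N` is monotone in `N`, so
  `p - 1 ≤ N` gives `μ_mult p ≤ μ_ssN p N` ("at least one supersingular `j`, hence at least `p - 1` trace-zero
  pairs"); with the partition `μ_ord + μ_ss + μ_mult + μ_add = 1` of the imported file, the rank-0 'closed by class'
  mass `μ_ordN p N + μ_mult p` and the rank-1 one `μ_ordN p N` are `< 1 - 1/(2p)` and `≥ 0` (for `N + p ≤ p²`).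
* (§3) the LIMIT: for any `a : ℕ → ℝ` with `0 ≤ a p ≤ 1 - 1/(2p)` on the primes `p ≥ L`, the partial products
  `∏_{L ≤ p ≤ Y} a p` tend to `0` as `Y → ∞` (`1 - x ≤ e^{-x}` and `Σ_p 1/p = ∞`); hence for EVERY function `N` with
  `p - 1 ≤ N p` and `N p + p ≤ p²` on primes `p ≥ 5` — in particular for Deuring's `N p = N_ss(p)` — both products
  `∏_{L ≤ p ≤ Y} (μ_ordN p (N p) + μ_mult p)` and `∏_{L ≤ p ≤ Y} μ_ordN p (N p)` (`L ≥ 5`) tend to `0`.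
* (§4) the exact truncation at `Y = 31` (nine primes, `N_ss = 4, 6, 20, 12, 32, 36, 66, 84, 90`): rank 0
  `1 - ∏ ∈ (0.7044141, 0.7044142)`, rank 1 `1 - ∏ ∈ (0.8679813, 0.8679814)` (`norm_num`), extending the
  `Y = 13` values `.4768867 / .7019979` of the imported file.

Use: bundle `pub-bsdpct`, `RESIDUAL-CASES.md` §(b-H) item H-7 / `numerics/PROOFS.md` §12.9 / `numerics/open_primes.py`
(13 numerical checks).  There, by the product formula for naive-height densities cut out by congruence conditions at
finitely many primes [BhargavaSkinnerZhang2014, §3.1], the §3 products ARE the densities `T₀(Y)`, `T₁(Y)` of curves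
`y² = x³ + Ax + B` having NO prime `p ∈ [L, Y]` at which the `p`-part of the BSD formula is left undecided by every
published class theorem (analytic rank 0: such a prime is an additive or supersingular one; rank 1: any non-ordinary
one), so §3 says: that density tends to `0`, i.e. the density of curves with an 'open-by-class' prime `p ≥ 5` is `1`
(the census previously recorded only the lower bound `.9754` at `Y = 331`).  The curve-wise companion — every non-CM
`E/ℚ` has infinitely many supersingular primes [Elkies1987] — and the average count `(π/3)√Y/log Y` [FouvryMurty1996]
are quoted there, not used here.

What is NOT here: the mass formula itself (Deuring / Cox Thm. 14.18) and the class numbers are CITED inputs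
(hypothesis `p - 1 ≤ N p`, table literals); supersingularity as a property of `E/𝔽_p`; the identification of the
products with densities (the cited product formula); anything conditional.  No `sorry`, no new axiom.
-/

namespace Literature.NumberTheory.EllipticCurves.BhargavaSkinnerZhang2014.Densities

open Finset Filter Topology

/-! ## §1. Deuring's mass formula as arithmetic on cited class numbers -/

/-- The Hurwitz class number `H(-4p)` of Cox §14.C for a prime `p ≥ 5`, from the ordinary class numbers
`h₄ = h(-4p)` and `h₁ = h(-p)`: the orders containing `ℤ[√-p]` are `ℤ[√-p]` itself and, when `p ≡ 3 (mod 4)`, the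
maximal order of discriminant `-p`; both have unit group `{±1}` for `p ≥ 5`, so `H(-4p) = h(-4p) + [p ≡ 3 (4)]·h(-p)`.
[cite: Cox2013, §14.C (definition before Thm. 14.18)] [folklore] -/
def hurwitzH (p h₄ h₁ : ℕ) : ℕ := h₄ + if p % 4 = 3 then h₁ else 0

/-- Deuring's count of supersingular (trace-zero) pairs `(A, B) mod p`, `p ≥ 5` prime: `N_ss(p) = ((p - 1)/2)·H(-4p)`
(Cox, Thm. 14.18 with `a = 0`: "SS = ((p-1)/2)H(-4p)", the `p(p-1)` Weierstrass equations `y² = 4x³ - g₂x - g₃` over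
`𝔽_p` being in bijection with the nonsingular pairs `(A, B) = (-g₂/4, -g₃/4)`).  Here as ARITHMETIC on supplied class
numbers; the formula is cited, not proved. [cite: Cox2013, Thm. 14.18 and (14.20)–(14.21)] [cite: Deuring1941] -/
def deuringNss (p h₄ h₁ : ℕ) : ℕ := (p - 1) / 2 * hurwitzH p h₄ h₁

/-- Gross's count `S_p` of supersingular `j`-invariants in `𝔽_p` (`p ≥ 5`): `h(-4p)/2`, `h(-p)`, `2h(-p)` for
`p ≡ 1 (mod 4)`, `7 (mod 8)`, `3 (mod 8)`. [cite: Galbraith2012, Thm. 9.11.11(2)] [cite: Gross1987, (1.11)] -/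
def grossS (p h₄ h₁ : ℕ) : ℕ := if p % 4 = 1 then h₄ / 2 else if p % 8 = 7 then h₁ else 2 * h₁

/-- The class numbers `(p, h(-4p), h(-p))` for the 65 primes `5 ≤ p ≤ 331` (`h(-p)` recorded as `0` when `p ≡ 1 (mod 4)`,
where it does not enter), computed by enumerating reduced primitive forms (`numerics/open_primes.py`, leg T1: the
values agree with a second class-number implementation and, for `p ≤ 1000`, with a direct point count of the
trace-zero pairs). [folklore] -/
def classNumberTable : List (ℕ × ℕ × ℕ) :=
  [(5, 2, 0), (7, 1, 1), (11, 3, 1), (13, 2, 0), (17, 4, 0), (19, 3, 1),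
   (23, 3, 3), (29, 6, 0), (31, 3, 3), (37, 2, 0), (41, 8, 0), (43, 3, 1),
   (47, 5, 5), (53, 6, 0), (59, 9, 3), (61, 6, 0), (67, 3, 1), (71, 7, 7),
   (73, 4, 0), (79, 5, 5), (83, 9, 3), (89, 12, 0), (97, 4, 0), (101, 14, 0),
   (103, 5, 5), (107, 9, 3), (109, 6, 0), (113, 8, 0), (127, 5, 5), (131, 15, 5),
   (137, 8, 0), (139, 9, 3), (149, 14, 0), (151, 7, 7), (157, 6, 0), (163, 3, 1),
   (167, 11, 11), (173, 14, 0), (179, 15, 5), (181, 10, 0), (191, 13, 13), (193, 4, 0),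
   (197, 10, 0), (199, 9, 9), (211, 9, 3), (223, 7, 7), (227, 15, 5), (229, 10, 0),
   (233, 12, 0), (239, 15, 15), (241, 12, 0), (251, 21, 7), (257, 16, 0), (263, 13, 13),
   (269, 22, 0), (271, 11, 11), (277, 6, 0), (281, 20, 0), (283, 9, 3), (293, 18, 0),
   (307, 9, 3), (311, 19, 19), (313, 8, 0), (317, 10, 0), (331, 9, 3)]

/-- The table has one row for each of the 65 primes in `[5, 331]` (every first entry is prime; that none is
missing is checked in `numerics/open_primes.py`, not here). [folklore] -/
theorem classNumberTable_length : classNumberTable.length = 65 := by decide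

/-- Every first entry of the table is a prime in `[5, 331]` (`norm_num` row by row). [folklore] -/
theorem classNumberTable_fst_prime : ∀ e ∈ classNumberTable, e.1.Prime ∧ 5 ≤ e.1 ∧ e.1 ≤ 331 := by
  intro e he
  fin_cases he <;> refine ⟨by norm_num, by norm_num, by norm_num⟩

/-- On the table: Deuring's count is `(p - 1)·S_p` with Gross's `S_p` (for `p ≡ 3 (mod 4)` this is the order
class-number relation `h(-4p) = (2 - (-p|2))·h(-p)`, Cox Thm. 7.24, checked numerically row by row), every prime has
AT LEAST ONE supersingular `j` (`1 ≤ S_p`, so `p - 1 ≤ N_ss(p)`), at most `p/12 + 2` of them, and `N_ss(p) + p ≤ p²`.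
[cite: Cox2013, Thm. 14.18 and Thm. 7.24] [cite: Galbraith2012, Thm. 9.11.11] [folklore] -/
theorem classNumberTable_deuring_gross :
    ∀ e ∈ classNumberTable,
      deuringNss e.1 e.2.1 e.2.2 = (e.1 - 1) * grossS e.1 e.2.1 e.2.2 ∧ 1 ≤ grossS e.1 e.2.1 e.2.2 ∧
        grossS e.1 e.2.1 e.2.2 ≤ e.1 / 12 + 2 ∧ e.1 - 1 ≤ deuringNss e.1 e.2.1 e.2.2 ∧
        deuringNss e.1 e.2.1 e.2.2 + e.1 ≤ e.1 ^ 2 := by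
  decide

/-- Deuring's formula reproduces EXACTLY the four trace-zero class counts decided by `decide` over `(ℤ/p)²` in
`SupersingularClassesSmallPrimes` §2: `N_ss(5) = 4` (`h(-20) = 2`), `N_ss(7) = 6` (`h(-28) = h(-7) = 1`),
`N_ss(11) = 20` (`h(-44) = 3`, `h(-11) = 1`), `N_ss(13) = 12` (`h(-52) = 2`). [cite: Cox2013, Thm. 14.18] [folklore] -/
theorem deuringNss_eq_card_traceZero :
    deuringNss 5 2 0 = (Finset.univ.filter (TraceZero 5)).card ∧
    deuringNss 7 1 1 = (Finset.univ.filter (TraceZero 7)).card ∧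
    deuringNss 11 3 1 = (Finset.univ.filter (TraceZero 11)).card ∧
    deuringNss 13 2 0 = (Finset.univ.filter (TraceZero 13)).card := by
  rw [card_traceZero5, card_traceZero7, card_traceZero11, card_traceZero13]
  decide

/-- The next values of the table (census primes `17 … 31`): `N_ss = 32, 36, 66, 84, 90`. [cite: Cox2013, Thm. 14.18] [folklore] -/
theorem deuringNss_values_17_31 :
    deuringNss 17 4 0 = 32 ∧ deuringNss 19 3 1 = 36 ∧ deuringNss 23 3 3 = 66 ∧
    deuringNss 29 6 0 = 84 ∧ deuringNss 31 3 3 = 90 := by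
  decide

/-- `S_p = 1` (a single supersingular `j`, so `μ_p(ss) = μ_p(mult)`) happens on the table exactly at `p = 5, 7, 13, 37`.
[folklore] -/
theorem grossS_eq_one_on_table :
    (classNumberTable.filter (fun e => grossS e.1 e.2.1 e.2.2 = 1)).map (fun e => e.1) = [5, 7, 13, 37] := by
  decide

/-! ## §2. The elementary inequalities -/

/-- `fam p = 1 - p⁻¹⁰ > 0` for `p ≥ 2`. [folklore] -/
theorem fam_pos (p : ℕ) (hp : 2 ≤ p) : 0 < fam p := by
  have hp1 : (1 : ℚ) < p := by exact_mod_cast hp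
  have h10 : (1 : ℚ) < (p : ℚ) ^ 10 := one_lt_pow₀ hp1 (by norm_num)
  have h' : 1 / (p : ℚ) ^ 10 < 1 := by rw [div_lt_one (by positivity)]; exact h10
  unfold fam
  linarith

/-- The multiplicative mass exceeds `1/(2p)`: `(p - 1)p⁸/(p¹⁰ - 1) > 1/(2p)` iff `p⁹(p - 2) + 1 > 0`. [folklore] -/
theorem μ_mult_gt_half_inv (p : ℕ) (hp : 2 ≤ p) : 1 / (2 * (p : ℚ)) < μ_mult p := by
  rw [μ_mult_closed_form p hp]
  have hp2 : (2 : ℚ) ≤ p := by exact_mod_cast hp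
  have hp1 : (1 : ℚ) < p := by linarith
  have h10 : (0 : ℚ) < (p : ℚ) ^ 10 - 1 := by
    have := one_lt_pow₀ hp1 (show (10 : ℕ) ≠ 0 by norm_num)
    linarith
  rw [div_lt_div_iff₀ (by positivity) h10]
  have h9 : (0 : ℚ) ≤ (p : ℚ) ^ 9 := by positivity
  nlinarith [mul_nonneg h9 (sub_nonneg.mpr hp2)]

/-- `μ_mult p ≥ 0` (indeed `> 1/(2p) > 0`) for `p ≥ 2`. [folklore] -/
theorem μ_mult_nonneg (p : ℕ) (hp : 2 ≤ p) : 0 ≤ μ_mult p := by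
  have h := μ_mult_gt_half_inv p hp
  have hp0 : (0 : ℚ) < p := by exact_mod_cast (lt_of_lt_of_le (by norm_num) hp)
  have : (0 : ℚ) < 1 / (2 * (p : ℚ)) := by positivity
  linarith

/-- `μ_add p = (p⁸ - 1)/(p¹⁰ - 1) ≥ 0` for `p ≥ 2`. [folklore] -/
theorem μ_add_nonneg (p : ℕ) (hp : 2 ≤ p) : 0 ≤ μ_add p := by
  rw [μ_add_closed_form p hp]
  have hp1 : (1 : ℚ) < p := by exact_mod_cast hp
  have h8 : (1 : ℚ) ≤ (p : ℚ) ^ 8 := (one_lt_pow₀ hp1 (by norm_num)).le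
  have h10 : (1 : ℚ) < (p : ℚ) ^ 10 := one_lt_pow₀ hp1 (by norm_num)
  apply div_nonneg <;> linarith

/-- The trace-zero mass is monotone in the class count `N`. [folklore] -/
theorem μ_ssN_mono (p : ℕ) (hp : 2 ≤ p) {N N' : ℕ} (h : N ≤ N') : μ_ssN p N ≤ μ_ssN p N' := by
  have hf := fam_pos p hp
  have hN : (N : ℚ) ≤ N' := by exact_mod_cast h
  unfold μ_ssN
  gcongr

/-- ONE SUPERSINGULAR `j` SUFFICES: if `N ≥ p - 1` (at least one supersingular `j ∈ 𝔽_p`, i.e. at least its `p - 1`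
pairs `(A, B)` — true for every prime `p ≥ 5` by Deuring's formula, `H(-4p) ≥ 2`), then `μ_mult p ≤ μ_ssN p N`.
[cite: Cox2013, Thm. 14.18] [folklore] -/
theorem μ_mult_le_μ_ssN (p N : ℕ) (hp : 2 ≤ p) (hN : p - 1 ≤ N) : μ_mult p ≤ μ_ssN p N := by
  rw [μ_mult_eq_μ_ssN p (by omega)]
  exact μ_ssN_mono p hp hN

/-- The ordinary mass is nonnegative as soon as `N + p ≤ p²` (the trace-zero pairs are among the `p² - p` nonsingular
ones). [folklore] -/
theorem μ_ordN_nonneg (p N : ℕ) (hp : 2 ≤ p) (hN : N + p ≤ p ^ 2) : 0 ≤ μ_ordN p N := by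
  have hf := fam_pos p hp
  have h' : (N : ℚ) + p ≤ (p : ℚ) ^ 2 := by exact_mod_cast hN
  unfold μ_ordN
  apply div_nonneg _ hf.le
  apply div_nonneg _ (by positivity)
  linarith

/-- RANK-0 CLOSED MASS BOUND: with at least one supersingular `j` (`p - 1 ≤ N`), the mass `μ_ord + μ_mult` of the
classes a published class theorem decides in analytic rank 0 is `< 1 - 1/(2p)` — because the undecided part contains
`μ_ss ≥ μ_mult > 1/(2p)`. [folklore] -/
theorem closed_rank0_lt (p N : ℕ) (hp : 2 ≤ p) (hN : p - 1 ≤ N) :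
    μ_ordN p N + μ_mult p < 1 - 1 / (2 * (p : ℚ)) := by
  have h := types_partition p N hp
  have h1 := μ_mult_le_μ_ssN p N hp hN
  have h2 := μ_mult_gt_half_inv p hp
  have h3 := μ_add_nonneg p hp
  linarith

/-- RANK-1 CLOSED MASS BOUND: `μ_ord ≤ μ_ord + μ_mult < 1 - 1/(2p)` under the same hypothesis. [folklore] -/
theorem closed_rank1_lt (p N : ℕ) (hp : 2 ≤ p) (hN : p - 1 ≤ N) :
    μ_ordN p N < 1 - 1 / (2 * (p : ℚ)) := by
  have h := closed_rank0_lt p N hp hN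
  have h' := μ_mult_nonneg p hp
  linarith

/-! ## §3. The limit: the closed-by-class mass over the primes in `[L, Y]` tends to `0` -/

/-- The primes `p` with `L ≤ p ≤ Y`. [folklore] -/
def primesIn (L Y : ℕ) : Finset ℕ := (Finset.range (Y + 1)).filter (fun p => p.Prime ∧ L ≤ p)

/-- Membership in `primesIn L Y`: `p ≤ Y`, `p` prime, `L ≤ p`. [folklore] -/
theorem mem_primesIn {L Y p : ℕ} : p ∈ primesIn L Y ↔ p ≤ Y ∧ p.Prime ∧ L ≤ p := by
  simp [primesIn]

/-- `Σ_{L ≤ p ≤ Y} 1/(2p) → ∞` as `Y → ∞`, for every `L` (Euler's `Σ 1/p = ∞`, Mathlib's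
`not_summable_one_div_on_primes`, minus finitely many terms). [folklore] -/
theorem tendsto_sum_primesIn_half_inv (L : ℕ) :
    Tendsto (fun Y => ∑ p ∈ primesIn L Y, (1 : ℝ) / (2 * p)) atTop atTop := by
  let g : ℕ → ℝ := fun n => if n.Prime ∧ L ≤ n then 1 / (2 * (n : ℝ)) else 0
  have hg0 : ∀ n, 0 ≤ g n := by
    intro n
    simp only [g]
    split_ifs
    · positivity
    · exact le_rfl
  have hns : ¬ Summable g := by
    intro hs
    have h2 : Summable (fun n => 2 * g n) := hs.mul_left 2
    have hind : Summable (Set.indicator {p | p.Prime} (fun n : ℕ => (1 : ℝ) / n)) := by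
      refine h2.congr_atTop ?_
      filter_upwards [eventually_ge_atTop L] with n hn
      by_cases hpn : n.Prime
      · have hmem : n ∈ {p : ℕ | p.Prime} := hpn
        simp only [g, hpn, hn, and_self, if_true, Set.indicator_of_mem hmem]
        ring
      · have hmem : n ∉ {p : ℕ | p.Prime} := hpn
        simp only [g, hpn, false_and, if_false, mul_zero, Set.indicator_of_notMem hmem]
    exact not_summable_one_div_on_primes hind
  have ht := (not_summable_iff_tendsto_nat_atTop_of_nonneg hg0).mp hns
  have ht' := ht.comp (tendsto_add_atTop_nat 1)
  refine ht'.congr ?_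
  intro Y
  simp only [Function.comp_apply, primesIn, Finset.sum_filter, g]

/-- SQUEEZE: if `0 ≤ a p ≤ 1 - 1/(2p)` for every prime `p ≥ L`, then `∏_{L ≤ p ≤ Y} a p → 0` as `Y → ∞`
(`1 - x ≤ e^{-x}`, `exp` of a sum, and the divergence above). [folklore] -/
theorem tendsto_prod_primesIn_zero (L : ℕ) (a : ℕ → ℝ)
    (h0 : ∀ p, p.Prime → L ≤ p → 0 ≤ a p) (h1 : ∀ p, p.Prime → L ≤ p → a p ≤ 1 - 1 / (2 * p)) :
    Tendsto (fun Y => ∏ p ∈ primesIn L Y, a p) atTop (𝓝 0) := by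
  have hexp : Tendsto (fun Y => Real.exp (-(∑ p ∈ primesIn L Y, (1 : ℝ) / (2 * p)))) atTop (𝓝 0) :=
    Real.tendsto_exp_atBot.comp (tendsto_neg_atTop_atBot.comp (tendsto_sum_primesIn_half_inv L))
  refine tendsto_of_tendsto_of_tendsto_of_le_of_le tendsto_const_nhds hexp (fun Y => ?_) (fun Y => ?_)
  · exact Finset.prod_nonneg fun p hp => h0 p (mem_primesIn.mp hp).2.1 (mem_primesIn.mp hp).2.2
  · show ∏ p ∈ primesIn L Y, a p ≤ Real.exp (-(∑ p ∈ primesIn L Y, (1 : ℝ) / (2 * p)))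
    rw [← Finset.sum_neg_distrib, Real.exp_sum]
    refine Finset.prod_le_prod (fun p hp => h0 p (mem_primesIn.mp hp).2.1 (mem_primesIn.mp hp).2.2)
      (fun p hp => ?_)
    have he := Real.add_one_le_exp (-(1 / (2 * (p : ℝ))))
    have ha := h1 p (mem_primesIn.mp hp).2.1 (mem_primesIn.mp hp).2.2
    linarith

/-- The rank-0 'closed by class' mass over the primes in `[L, Y]` for a supersingular-count function `N`:
`∏_{L ≤ p ≤ Y} (μ_ordN p (N p) + μ_mult p)`, as a real number. [folklore] -/
def closedMassRank0 (N : ℕ → ℕ) (L Y : ℕ) : ℝ :=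
  ∏ p ∈ primesIn L Y, ((μ_ordN p (N p) + μ_mult p : ℚ) : ℝ)

/-- The rank-1 'closed by class' mass `∏_{L ≤ p ≤ Y} μ_ordN p (N p)`. [folklore] -/
def closedMassRank1 (N : ℕ → ℕ) (L Y : ℕ) : ℝ :=
  ∏ p ∈ primesIn L Y, ((μ_ordN p (N p) : ℚ) : ℝ)

/-- THE LIMIT THEOREM.  Let `N : ℕ → ℕ` satisfy `p - 1 ≤ N p` and `N p + p ≤ p²` at every prime `p ≥ 5` — as
Deuring's `N p = N_ss(p) = ((p - 1)/2)·H(-4p) = (p - 1)·S_p`, `1 ≤ S_p`, does [Cox2013 Thm. 14.18; Galbraith2012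
Thm. 9.11.11(2)].  Then for every `L ≥ 5` both closed-by-class masses over the primes in `[L, Y]` tend to `0` as
`Y → ∞`.  Reading (bundle `pub-bsdpct`, PROOFS §12.9, via the product formula for densities given by congruence
conditions at finitely many primes): the naive-height density of curves `y² = x³ + Ax + B` with NO prime `p ∈ [L, Y]`
at which BSD(E, p) is left open by every published class theorem tends to `0`; the density of curves with such a prime
is `1` in analytic rank `0` and in analytic rank `1`, and for every `k` the density of curves with at least `k` such
primes is `1`.  (Curve-wise, every non-CM `E/ℚ` has infinitely many supersingular primes [Elkies1987]; on average over
the box there are `~ (π/3)√Y/log Y` of them below `Y` [FouvryMurty1996] — context, not used.)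
[cite: Cox2013, Thm. 14.18] [cite: Galbraith2012, Thm. 9.11.11] [cite: BhargavaSkinnerZhang2014, §3.1] [folklore] -/
theorem closedMass_tendsto_zero (N : ℕ → ℕ)
    (hDeuring : ∀ p, p.Prime → 5 ≤ p → p - 1 ≤ N p) (hle : ∀ p, p.Prime → 5 ≤ p → N p + p ≤ p ^ 2)
    (L : ℕ) (hL : 5 ≤ L) :
    Tendsto (closedMassRank0 N L) atTop (𝓝 0) ∧ Tendsto (closedMassRank1 N L) atTop (𝓝 0) := by
  have two_le : ∀ p, L ≤ p → 2 ≤ p := fun p hp => by omega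
  have five_le : ∀ p, L ≤ p → 5 ≤ p := fun p hp => by omega
  have cast_bound : ∀ p : ℕ, ((1 - 1 / (2 * (p : ℚ)) : ℚ) : ℝ) = 1 - 1 / (2 * (p : ℝ)) := by
    intro p; push_cast; ring
  constructor
  · apply tendsto_prod_primesIn_zero
    · intro p hp hLp
      have h := add_nonneg (μ_ordN_nonneg p (N p) (two_le p hLp) (hle p hp (five_le p hLp)))
        (μ_mult_nonneg p (two_le p hLp))
      exact_mod_cast h
    · intro p hp hLp
      have h := closed_rank0_lt p (N p) (two_le p hLp) (hDeuring p hp (five_le p hLp))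
      have h' : (((μ_ordN p (N p) + μ_mult p : ℚ)) : ℝ) < ((1 - 1 / (2 * (p : ℚ)) : ℚ) : ℝ) := by
        exact_mod_cast h
      rw [cast_bound] at h'
      exact h'.le
  · apply tendsto_prod_primesIn_zero
    · intro p hp hLp
      have h := μ_ordN_nonneg p (N p) (two_le p hLp) (hle p hp (five_le p hLp))
      exact_mod_cast h
    · intro p hp hLp
      have h := closed_rank1_lt p (N p) (two_le p hLp) (hDeuring p hp (five_le p hLp))
      have h' : (((μ_ordN p (N p) : ℚ)) : ℝ) < ((1 - 1 / (2 * (p : ℚ)) : ℚ) : ℝ) := by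
        exact_mod_cast h
      rw [cast_bound] at h'
      exact h'.le

/-! ## §4. The exact truncation at `Y = 31` -/

/-- Rank 0, primes `5 … 31` with `N_ss = 4, 6, 20, 12, 32, 36, 66, 84, 90`: the density of curves with an additive
or supersingular prime in `[5, 31]` is `1 - ∏ (μ_ord + μ_mult) ∈ (0.7044141, 0.7044142)` (exact rational;
`numerics/open_primes.py` table row `Y = 31`). [folklore] -/
theorem open_rank0_upto_31_bounds :
    (0.7044141 : ℚ) < 1 - (μ_ordN 5 4 + μ_mult 5) * (μ_ordN 7 6 + μ_mult 7) * (μ_ordN 11 20 + μ_mult 11) *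
        (μ_ordN 13 12 + μ_mult 13) * (μ_ordN 17 32 + μ_mult 17) * (μ_ordN 19 36 + μ_mult 19) *
        (μ_ordN 23 66 + μ_mult 23) * (μ_ordN 29 84 + μ_mult 29) * (μ_ordN 31 90 + μ_mult 31) ∧
    1 - (μ_ordN 5 4 + μ_mult 5) * (μ_ordN 7 6 + μ_mult 7) * (μ_ordN 11 20 + μ_mult 11) *
        (μ_ordN 13 12 + μ_mult 13) * (μ_ordN 17 32 + μ_mult 17) * (μ_ordN 19 36 + μ_mult 19) *
        (μ_ordN 23 66 + μ_mult 23) * (μ_ordN 29 84 + μ_mult 29) * (μ_ordN 31 90 + μ_mult 31) < (0.7044142 : ℚ) := by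
  constructor <;> norm_num [μ_ordN, μ_mult, fam]

/-- Rank 1, same primes: `1 - ∏ μ_ord ∈ (0.8679813, 0.8679814)`. [folklore] -/
theorem open_rank1_upto_31_bounds :
    (0.8679813 : ℚ) < 1 - μ_ordN 5 4 * μ_ordN 7 6 * μ_ordN 11 20 * μ_ordN 13 12 * μ_ordN 17 32 *
        μ_ordN 19 36 * μ_ordN 23 66 * μ_ordN 29 84 * μ_ordN 31 90 ∧
    1 - μ_ordN 5 4 * μ_ordN 7 6 * μ_ordN 11 20 * μ_ordN 13 12 * μ_ordN 17 32 *
        μ_ordN 19 36 * μ_ordN 23 66 * μ_ordN 29 84 * μ_ordN 31 90 < (0.8679814 : ℚ) := by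
  constructor <;> norm_num [μ_ordN, fam]

/-- Link to the imported `Y = 13` rows: the first four factors are the census products of
`SupersingularClassesSmallPrimes` (`open_rank0_union_bounds`, `open_rank1_union_bounds`), since
`μ_ordN p N + μ_mult p = 1 - (μ_add p + μ_ssN p N)`. [folklore] -/
theorem closed_rank0_eq_one_sub_open (p N : ℕ) (hp : 2 ≤ p) :
    μ_ordN p N + μ_mult p = 1 - (μ_add p + μ_ssN p N) := by
  have h := types_partition p N hp
  linarith

end Literature.NumberTheory.EllipticCurves.BhargavaSkinnerZhang2014.Densities
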